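import Mathlib.LinearAlgebra.Eigenspace.Pi
import Mathlib.LinearAlgebra.Basis.Flag
import Mathlib.LinearAlgebra.FiniteDimensional.Lemmas
import Mathlib.LinearAlgebra.Matrix.ToLin
import Mathlib.RingTheory.Valuation.ValuationSubring
import Mathlib.RingTheory.LocalRing.ResidueField.Basic
import HarnessLib

/-!
# Counting simultaneous generalised eigenvalues along a triangularising basis (proofs only)

Helper file (theorems only: no definition, no named fact; D-0026) of the seat of the named fact
`Literature.NumberTheory.EllipticCurves.hida_exists_congruent_ordinary_newform`
(`HidaFamilyMembers.lean`).  The classical reduction of that fact to Hida's rank constancy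
(Hida, *Elementary Modular Iwasawa Theory* (2022), Lemma 4.1.25 = Cor. 4.2.32) counts Hecke
eigensystems with multiplicity, in characteristic `0` and modulo `p`; the linear algebra of that
count is done here once and for all:

* `finrank_iInf_maxGenEigenspace_le_card` — for a family of endomorphisms `f t` of a
  finite-dimensional vector space which is upper triangular in a basis `b` indexed by `Fin n`,
  with diagonal entries `θ i t`, the simultaneous generalised eigenspace
  `⨅ t, (f t).maxGenEigenspace (χ t)` of a character `χ` has dimension at most
  `#{i | θ i = χ}` (any field, no commutativity);
* `finrank_iInf_maxGenEigenspace_eq_card` — equality, when the `f t` commute and the field is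
  algebraically closed (the simultaneous generalised eigenspaces then span, Mathlib's
  `Module.End.iSup_iInf_maxGenEigenspace_eq_top_of_iSup_maxGenEigenspace_eq_top_of_commute`);
* `finrank_iInf_maxGenEigenspace_le_of_injective` — an injective intertwiner of two families does
  not decrease these dimensions;
* `exists_adapted_pivot_family` — Gaussian elimination with pivoting by valuation: over a valuation
  subring `A ⊆ K`, every flag of `K^J` is the flag of an `A`-integral family with unit pivots
  (`GL_J(K) = GL_J(A) · B(K)`);
* `finrank_iInf_maxGenEigenspace_residue_eq_card` — **decomposition numbers**: for pairwise
  commuting matrices over `A` which are simultaneously triangular over `K` with diagonal characters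
  `θ i`, the simultaneous generalised eigenspaces of their reductions modulo the maximal ideal of
  `A` (acting on `k^J`, `k` the residue field, assumed algebraically closed) have dimensions
  `#{i | θ i mod 𝔪 = χ}`.

[folklore] (Bourbaki, *Algèbre* VII §5; the multiset of diagonal characters of a triangular form
of a commuting family is the multiset of its simultaneous generalised eigenvalues.)
-/

noncomputable section

open Module Module.End Submodule

namespace Literature.NumberTheory.EllipticCurves.ModularForms.HidaRank

universe u v w

variable {K : Type u} [Field K] {V : Type v} [AddCommGroup V] [Module K V]
variable {τ : Type w} {n : ℕ}

/-! ### Triangular families -/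

section Triangular

variable (b : Module.Basis (Fin n) K V) (f : τ → Module.End K V) (θ : Fin n → τ → K)

/-- The flag of a triangularising basis is stable. [folklore] -/
theorem map_flag_le_flag
    (htri : ∀ t i, f t (b i) - θ i t • b i ∈ b.flag i.castSucc) (t : τ) (k : Fin (n + 1)) :
    (b.flag k).map (f t) ≤ b.flag k := by
  induction k using Fin.induction with
  | zero => simp
  | succ k ih =>
    rw [Submodule.map_le_iff_le_comap, b.flag_succ, sup_le_iff]
    refine ⟨?_, ?_⟩
    · rw [Submodule.span_singleton_le_iff_mem, Submodule.mem_comap]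
      have h1 : f t (b k) = (f t (b k) - θ k t • b k) + θ k t • b k := by abel
      rw [h1]
      refine Submodule.add_mem _ (Submodule.mem_sup_right (htri t k))
        (Submodule.mem_sup_left (Submodule.smul_mem _ _ (Submodule.mem_span_singleton_self _)))
    · intro x hx
      rw [Submodule.mem_comap]
      have : f t x ∈ (b.flag k.castSucc).map (f t) := Submodule.mem_map_of_mem hx
      exact Submodule.mem_sup_right (ih this)

/-- Membership in the flag is stable under a triangular endomorphism. [folklore] -/
theorem apply_mem_flag (htri : ∀ t i, f t (b i) - θ i t • b i ∈ b.flag i.castSucc) (t : τ)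
    {k : Fin (n + 1)} {x : V} (hx : x ∈ b.flag k) : f t x ∈ b.flag k :=
  map_flag_le_flag b f θ htri t k (Submodule.mem_map_of_mem hx)

/-- The `k`-th coordinate vanishes on the `k`-th step of the flag. [folklore] -/
theorem coord_eq_zero_of_mem_flag {k : Fin n} {x : V} (hx : x ∈ b.flag k.castSucc) :
    b.coord k x = 0 :=
  LinearMap.mem_ker.mp (b.flag_le_ker_coord le_rfl hx)

/-- An element of the `(k+1)`-st step with vanishing `k`-th coordinate lies in the `k`-th step.
[folklore] -/
theorem mem_flag_castSucc_of_coord_eq_zero {k : Fin n} {x : V} (hx : x ∈ b.flag k.succ)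
    (h0 : b.coord k x = 0) : x ∈ b.flag k.castSucc := by
  rw [b.flag_succ, Submodule.mem_sup] at hx
  obtain ⟨y, hy, z, hz, rfl⟩ := hx
  obtain ⟨c, rfl⟩ := Submodule.mem_span_singleton.mp hy
  have hz0 : b.coord k z = 0 := coord_eq_zero_of_mem_flag b hz
  have h1 : b.coord k (b k) = 1 := by simp [Module.Basis.coord_apply, Module.Basis.repr_self]
  have : c = 0 := by
    rw [map_add, map_smul, hz0, h1, smul_eq_mul, mul_one, add_zero] at h0
    exact h0
  subst this
  simpa using hz

/-- The diagonal entry: on the `(k+1)`-st step of the flag, the `k`-th coordinate of `f t x` is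
`θ k t` times that of `x`. [folklore] -/
theorem coord_apply_of_mem_flag_succ
    (htri : ∀ t i, f t (b i) - θ i t • b i ∈ b.flag i.castSucc) (t : τ) {k : Fin n} {x : V}
    (hx : x ∈ b.flag k.succ) : b.coord k (f t x) = θ k t * b.coord k x := by
  rw [b.flag_succ, Submodule.mem_sup] at hx
  obtain ⟨y, hy, z, hz, rfl⟩ := hx
  obtain ⟨c, rfl⟩ := Submodule.mem_span_singleton.mp hy
  have hz0 : b.coord k z = 0 := coord_eq_zero_of_mem_flag b hz
  have hfz : b.coord k (f t z) = 0 := coord_eq_zero_of_mem_flag b (apply_mem_flag b f θ htri t hz)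
  have h1 : b.coord k (b k) = 1 := by simp [Module.Basis.coord_apply, Module.Basis.repr_self]
  have hfb : b.coord k (f t (b k)) = θ k t := by
    have h2 : f t (b k) = (f t (b k) - θ k t • b k) + θ k t • b k := by abel
    rw [h2, map_add, coord_eq_zero_of_mem_flag b (htri t k), map_smul, h1, smul_eq_mul, mul_one,
      zero_add]
  simp only [map_add, map_smul, hfz, hz0, hfb, h1, smul_eq_mul, add_zero, mul_one]
  ring

/-- Iterating the diagonal entry for `f t - c`. [folklore] -/
theorem coord_pow_apply_of_mem_flag_succ
    (htri : ∀ t i, f t (b i) - θ i t • b i ∈ b.flag i.castSucc) (t : τ) (c : K) {k : Fin n}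
    (m : ℕ) {x : V} (hx : x ∈ b.flag k.succ) :
    b.coord k (((f t - c • 1) ^ m) x) = (θ k t - c) ^ m * b.coord k x := by
  induction m generalizing x with
  | zero => simp
  | succ m ih =>
    have hx' : (f t - c • 1) x ∈ b.flag k.succ := by
      rw [LinearMap.sub_apply, LinearMap.smul_apply, Module.End.one_apply]
      exact Submodule.sub_mem _ (apply_mem_flag b f θ htri t hx) (Submodule.smul_mem _ _ hx)
    rw [pow_succ, Module.End.mul_apply, ih hx', LinearMap.sub_apply, LinearMap.smul_apply,
      Module.End.one_apply, map_sub, map_smul, coord_apply_of_mem_flag_succ b f θ htri t hx]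
    ring

/-- **Upper bound.** The simultaneous generalised eigenspace of `χ` meets the `k`-th step of the
flag in dimension at most `#{i < k | θ i = χ}`. [folklore] -/
theorem finrank_iInf_maxGenEigenspace_inf_flag_le_card [FiniteDimensional K V] [DecidableEq (τ → K)]
    (htri : ∀ t i, f t (b i) - θ i t • b i ∈ b.flag i.castSucc) (χ : τ → K) (k : Fin (n + 1)) :
    finrank K ↥((⨅ t, (f t).maxGenEigenspace (χ t)) ⊓ b.flag k) ≤
      (Finset.univ.filter fun i : Fin n ↦ i.castSucc < k ∧ θ i = χ).card := by
  set S : Submodule K V := ⨅ t, (f t).maxGenEigenspace (χ t) with hS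
  induction k using Fin.induction with
  | zero => simp
  | succ k ih =>
    -- the new elements counted at step `k+1`
    have hcard : (Finset.univ.filter fun i : Fin n ↦ i.castSucc < k.succ ∧ θ i = χ).card =
        (Finset.univ.filter fun i : Fin n ↦ i.castSucc < k.castSucc ∧ θ i = χ).card +
          (if θ k = χ then 1 else 0) := by
      have hsplit : (Finset.univ.filter fun i : Fin n ↦ i.castSucc < k.succ ∧ θ i = χ) =
          (Finset.univ.filter fun i : Fin n ↦ i.castSucc < k.castSucc ∧ θ i = χ) ∪
            (if θ k = χ then {k} else ∅) := by
        ext i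
        simp only [Finset.mem_filter, Finset.mem_univ, true_and, Finset.mem_union]
        constructor
        · rintro ⟨hi, hθ⟩
          rcases (Fin.castSucc_lt_succ_iff.mp hi).lt_or_eq with h | h
          · exact Or.inl ⟨Fin.castSucc_lt_castSucc_iff.mpr h, hθ⟩
          · subst h
            simp [hθ]
        · rintro (⟨hi, hθ⟩ | hi)
          · exact ⟨hi.trans (Fin.castSucc_lt_succ (i := k)), hθ⟩
          · split_ifs at hi with hθ
            · simp only [Finset.mem_singleton] at hi
              subst hi
              exact ⟨Fin.castSucc_lt_succ (i := i), hθ⟩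
            · simp at hi
      rw [hsplit, Finset.card_union_of_disjoint]
      · congr 1
        split_ifs <;> simp
      · split_ifs
        · simp only [Finset.disjoint_singleton_right, Finset.mem_filter, Finset.mem_univ,
            true_and, not_and]
          exact fun h _ ↦ (lt_irrefl _ h).elim
        · simp
    rw [hcard]
    by_cases hθ : θ k = χ
    · -- at most one new dimension
      rw [if_pos hθ]
      by_cases hle : S ⊓ b.flag k.succ ≤ b.flag k.castSucc
      · have : S ⊓ b.flag k.succ = S ⊓ b.flag k.castSucc :=
          le_antisymm (le_inf inf_le_left hle)
            (inf_le_inf_left _ (b.flag_mono (Fin.castSucc_lt_succ (i := k)).le))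
        rw [this]
        exact (ih).trans (Nat.le_add_right _ _)
      · obtain ⟨v, hvS, hv⟩ := Set.not_subset.mp hle
        have hv0 : b.coord k v ≠ 0 := fun h0 ↦
          hv (mem_flag_castSucc_of_coord_eq_zero b (Submodule.mem_inf.mp hvS).2 h0)
        have hsub : S ⊓ b.flag k.succ ≤ (S ⊓ b.flag k.castSucc) ⊔ K ∙ v := by
          intro x hx
          obtain ⟨hxS, hxf⟩ := Submodule.mem_inf.mp hx
          set c : K := b.coord k x / b.coord k v with hc
          have hxv : x - c • v ∈ S ⊓ b.flag k.castSucc := by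
            refine Submodule.mem_inf.mpr ⟨Submodule.sub_mem _ hxS
              (Submodule.smul_mem _ _ (Submodule.mem_inf.mp hvS).1), ?_⟩
            refine mem_flag_castSucc_of_coord_eq_zero b (Submodule.sub_mem _ hxf
              (Submodule.smul_mem _ _ (Submodule.mem_inf.mp hvS).2)) ?_
            rw [map_sub, map_smul, smul_eq_mul, hc, div_mul_cancel₀ _ hv0, sub_self]
          rw [Submodule.mem_sup]
          exact ⟨x - c • v, hxv, c • v, Submodule.smul_mem _ _ (Submodule.mem_span_singleton_self v),
            sub_add_cancel x _⟩
        calc finrank K ↥(S ⊓ b.flag k.succ)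
            ≤ finrank K ↥((S ⊓ b.flag k.castSucc) ⊔ K ∙ v) := Submodule.finrank_mono hsub
          _ ≤ finrank K ↥(S ⊓ b.flag k.castSucc) + finrank K ↥(K ∙ v) :=
              Submodule.finrank_add_le_finrank_add_finrank _ _
          _ ≤ _ := Nat.add_le_add ih ((finrank_span_le_card ({v} : Set V)).trans (by simp))
    · -- no new dimension: the intersection is already in the previous step
      rw [if_neg hθ, add_zero]
      have hle : S ⊓ b.flag k.succ ≤ b.flag k.castSucc := by
        intro x hx
        obtain ⟨hxS, hxf⟩ := Submodule.mem_inf.mp hx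
        obtain ⟨t, ht⟩ : ∃ t, θ k t ≠ χ t := Function.ne_iff.mp hθ
        have hxt : x ∈ (f t).maxGenEigenspace (χ t) := (Submodule.mem_iInf _).mp hxS t
        rw [Module.End.mem_maxGenEigenspace] at hxt
        obtain ⟨m, hm⟩ := hxt
        have h := coord_pow_apply_of_mem_flag_succ b f θ htri t (χ t) m hxf
        rw [hm, map_zero] at h
        have hc : b.coord k x = 0 := by
          rcases mul_eq_zero.mp h.symm with h1 | h1
          · exact absurd (eq_zero_of_pow_eq_zero h1 |> sub_eq_zero.mp) ht
          · exact h1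
        exact mem_flag_castSucc_of_coord_eq_zero b hxf hc
      have : S ⊓ b.flag k.succ = S ⊓ b.flag k.castSucc :=
        le_antisymm (le_inf inf_le_left hle)
          (inf_le_inf_left _ (b.flag_mono (Fin.castSucc_lt_succ (i := k)).le))
      rw [this]
      exact ih

/-- **Upper bound** (whole space): `dim ⨅ t, (f t).maxGenEigenspace (χ t) ≤ #{i | θ i = χ}` for a
family triangular in the basis `b` with diagonal characters `θ i`. [folklore] -/
theorem finrank_iInf_maxGenEigenspace_le_card [FiniteDimensional K V] [DecidableEq (τ → K)]
    (htri : ∀ t i, f t (b i) - θ i t • b i ∈ b.flag i.castSucc) (χ : τ → K) :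
    finrank K ↥(⨅ t, (f t).maxGenEigenspace (χ t)) ≤
      (Finset.univ.filter fun i : Fin n ↦ θ i = χ).card := by
  have h := finrank_iInf_maxGenEigenspace_inf_flag_le_card b f θ htri χ (Fin.last n)
  rw [b.flag_last, inf_top_eq] at h
  refine h.trans (le_of_eq ?_)
  congr 1
  ext i
  simp [Fin.castSucc_lt_last]

end Triangular

/-! ### The dimension of a finite supremum -/

omit [Field K] [AddCommGroup V] [Module K V] in
/-- `dim (⨆_{i ∈ s} p i) ≤ ∑_{i ∈ s} dim (p i)`. [folklore] -/
theorem finrank_biSup_le_sum {K : Type u} [Field K] {V : Type v} [AddCommGroup V] [Module K V]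
    [FiniteDimensional K V] {ι : Type*} (s : Finset ι) (p : ι → Submodule K V) :
    finrank K ↥(⨆ i ∈ s, p i) ≤ ∑ i ∈ s, finrank K ↥(p i) := by
  classical
  induction s using Finset.induction_on with
  | empty => simp
  | insert a s ha ih =>
    rw [Finset.iSup_insert, Finset.sum_insert ha]
    exact (Submodule.finrank_add_le_finrank_add_finrank _ _).trans (Nat.add_le_add_left ih _)

/-! ### Equality for commuting families over an algebraically closed field -/

section Commuting

variable [IsAlgClosed K] [FiniteDimensional K V]
variable (b : Module.Basis (Fin n) K V) (f : τ → Module.End K V) (θ : Fin n → τ → K)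

/-- **The multiset of diagonal characters is the multiset of simultaneous generalised
eigenvalues**: for a commuting family `f t` of endomorphisms of a finite-dimensional vector space
over an algebraically closed field, upper triangular in the basis `b` with diagonal characters
`θ i : τ → K`, and any `χ : τ → K`,
`dim ⨅ t, (f t).maxGenEigenspace (χ t) = #{i | θ i = χ}`. [folklore] -/
theorem finrank_iInf_maxGenEigenspace_eq_card [DecidableEq (τ → K)]
    (htri : ∀ t i, f t (b i) - θ i t • b i ∈ b.flag i.castSucc)
    (hcomm : ∀ s t, Commute (f s) (f t)) (χ : τ → K) :
    finrank K ↥(⨅ t, (f t).maxGenEigenspace (χ t)) =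
      (Finset.univ.filter fun i : Fin n ↦ θ i = χ).card := by
  classical
  -- the simultaneous generalised eigenspaces span
  have htop : ⨆ χ : τ → K, ⨅ t, (f t).maxGenEigenspace (χ t) = ⊤ := by
    refine Module.End.iSup_iInf_maxGenEigenspace_eq_top_of_iSup_maxGenEigenspace_eq_top_of_commute
      f (fun s t _ ↦ hcomm s t) fun t ↦ Module.End.iSup_maxGenEigenspace_eq_top (f t)
  -- only the diagonal characters contribute
  set E : (τ → K) → Submodule K V := fun χ ↦ ⨅ t, (f t).maxGenEigenspace (χ t) with hE
  set Θ : Finset (τ → K) := Finset.univ.image θ with hΘ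
  have hle : ∀ χ, finrank K ↥(E χ) ≤ (Finset.univ.filter fun i : Fin n ↦ θ i = χ).card :=
    fun χ ↦ finrank_iInf_maxGenEigenspace_le_card b f θ htri χ
  have hzero : ∀ χ, χ ∉ Θ → E χ = ⊥ := by
    intro χ hχ
    have h0 : (Finset.univ.filter fun i : Fin n ↦ θ i = χ).card = 0 := by
      rw [Finset.card_eq_zero, Finset.filter_eq_empty_iff]
      intro i _ h
      exact hχ (Finset.mem_image.mpr ⟨i, Finset.mem_univ _, h⟩)
    have := hle χ
    rw [h0, Nat.le_zero] at this
    exact Submodule.finrank_eq_zero.mp this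
  have htop' : ⨆ χ ∈ Θ, E χ = ⊤ := by
    rw [eq_top_iff, ← htop, iSup_le_iff]
    intro χ
    by_cases hχ : χ ∈ Θ
    · exact le_biSup E hχ
    · rw [hzero χ hχ]
      exact bot_le
  -- dimension count
  have hsum : ∑ χ ∈ Θ, (Finset.univ.filter fun i : Fin n ↦ θ i = χ).card = n := by
    rw [hΘ, ← Finset.card_eq_sum_card_image, Finset.card_univ, Fintype.card_fin]
  have hV : finrank K V = n := by simpa using (finrank_eq_card_basis b)
  have hge : n ≤ ∑ χ ∈ Θ, finrank K ↥(E χ) := by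
    calc n = finrank K V := hV.symm
      _ = finrank K ↥(⊤ : Submodule K V) := (finrank_top K V).symm
      _ = finrank K ↥(⨆ χ ∈ Θ, E χ) := by rw [htop']
      _ ≤ _ := finrank_biSup_le_sum Θ E
  -- termwise equality
  have heq : ∀ χ' ∈ Θ, finrank K ↥(E χ') = (Finset.univ.filter fun i : Fin n ↦ θ i = χ').card := by
    have hge' : ∑ χ' ∈ Θ, (Finset.univ.filter fun i : Fin n ↦ θ i = χ').card ≤
        ∑ χ' ∈ Θ, finrank K ↥(E χ') := by
      rw [hsum]
      exact hge
    exact (Finset.sum_eq_sum_iff_of_le fun χ' (_ : χ' ∈ Θ) ↦ hle χ').mp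
      (le_antisymm (Finset.sum_le_sum fun χ' _ ↦ hle χ') hge')
  by_cases hχ : χ ∈ Θ
  · exact heq χ hχ
  · rw [show (⨅ t, (f t).maxGenEigenspace (χ t)) = E χ from rfl, hzero χ hχ, finrank_bot]
    symm
    rw [Finset.card_eq_zero, Finset.filter_eq_empty_iff]
    intro i _ h
    exact hχ (Finset.mem_image.mpr ⟨i, Finset.mem_univ _, h⟩)

end Commuting

/-! ### Intertwining maps -/

section Intertwine

variable {W : Type*} [AddCommGroup W] [Module K W]

omit [Field K] in
/-- An intertwining map sends simultaneous generalised eigenvectors to simultaneous generalised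
eigenvectors. [folklore] -/
theorem map_iInf_maxGenEigenspace_le {K : Type u} [Field K] {V : Type v} [AddCommGroup V]
    [Module K V] {W : Type*} [AddCommGroup W] [Module K W] (f : V →ₗ[K] W)
    (A : τ → Module.End K V) (B : τ → Module.End K W) (h : ∀ t v, f (A t v) = B t (f v))
    (χ : τ → K) :
    (⨅ t, (A t).maxGenEigenspace (χ t)).map f ≤ ⨅ t, (B t).maxGenEigenspace (χ t) := by
  rintro _ ⟨v, hv, rfl⟩
  rw [SetLike.mem_coe, Submodule.mem_iInf] at hv
  rw [Submodule.mem_iInf]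
  intro t
  have hvt := hv t
  rw [Module.End.mem_maxGenEigenspace] at hvt ⊢
  obtain ⟨k, hk⟩ := hvt
  refine ⟨k, ?_⟩
  have hpow : ∀ (k : ℕ) (v : V), f (((A t - χ t • 1) ^ k) v) = ((B t - χ t • 1) ^ k) (f v) := by
    intro k
    induction k with
    | zero => intro v; simp
    | succ k ih =>
      intro v
      rw [pow_succ, pow_succ, Module.End.mul_apply, Module.End.mul_apply, ih]
      simp [h]
  rw [← hpow, hk, map_zero]

omit [Field K] in
/-- **Monotonicity under injective intertwiners**: an injective linear map intertwining two
families does not decrease the dimensions of simultaneous generalised eigenspaces. [folklore] -/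
theorem finrank_iInf_maxGenEigenspace_le_of_injective {K : Type u} [Field K] {V : Type v}
    [AddCommGroup V] [Module K V] {W : Type*} [AddCommGroup W] [Module K W]
    [FiniteDimensional K W] (f : V →ₗ[K] W) (hf : Function.Injective f)
    (A : τ → Module.End K V) (B : τ → Module.End K W) (h : ∀ t v, f (A t v) = B t (f v))
    (χ : τ → K) :
    finrank K ↥(⨅ t, (A t).maxGenEigenspace (χ t)) ≤
      finrank K ↥(⨅ t, (B t).maxGenEigenspace (χ t)) := by
  haveI : FiniteDimensional K V := Module.Finite.of_injective f hf
  calc finrank K ↥(⨅ t, (A t).maxGenEigenspace (χ t))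
      = finrank K ↥((⨅ t, (A t).maxGenEigenspace (χ t)).map f) :=
        (LinearEquiv.finrank_eq (Submodule.equivMapOfInjective f hf _))
    _ ≤ _ := Submodule.finrank_mono (map_iInf_maxGenEigenspace_le f A B h χ)

end Intertwine

/-! ### Changing the triangularising basis along the same flag -/

section FlagTransfer

variable (b b' : Module.Basis (Fin n) K V) (f : τ → Module.End K V) (θ : Fin n → τ → K)

/-- Triangularity with given diagonal characters only depends on the flag of the basis.
[folklore] -/
theorem triangular_of_flag_eq (htri : ∀ t i, f t (b i) - θ i t • b i ∈ b.flag i.castSucc)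
    (hflag : ∀ k, b'.flag k = b.flag k) (t : τ) (i : Fin n) :
    f t (b' i) - θ i t • b' i ∈ b'.flag i.castSucc := by
  have hi : b' i ∈ b.flag i.succ := by
    rw [← hflag]
    exact b'.self_mem_flag (Fin.castSucc_lt_succ (i := i))
  rw [b.flag_succ, Submodule.mem_sup] at hi
  obtain ⟨y, hy, z, hz, hyz⟩ := hi
  obtain ⟨c, rfl⟩ := Submodule.mem_span_singleton.mp hy
  rw [hflag, ← hyz]
  have h1 : f t (c • b i + z) - θ i t • (c • b i + z) =
      c • (f t (b i) - θ i t • b i) + (f t z - θ i t • z) := by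
    simp only [map_add, map_smul, smul_sub, smul_add, smul_smul, mul_comm c]
    abel
  rw [h1]
  exact Submodule.add_mem _ (Submodule.smul_mem _ _ (htri t i))
    (Submodule.sub_mem _ (apply_mem_flag b f θ htri t hz) (Submodule.smul_mem _ _ hz))

end FlagTransfer

/-! ### Pivot families of vectors -/

section Pivot

variable {J : Type*} [Fintype J]

omit [Fintype J] in
/-- A family of vectors `u a : J → K` with *pivots* `π a` — `u a (π a) = 1` and `u b (π a) = 0`
for `a < b` — is linearly independent. [folklore] -/
theorem linearIndependent_of_pivots (u : Fin n → J → K) (π : Fin n → J)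
    (hdiag : ∀ a, u a (π a) = 1) (hlow : ∀ a b, a < b → u b (π a) = 0) :
    LinearIndependent K u := by
  rw [Fintype.linearIndependent_iff]
  intro g hg
  suffices h : ∀ (k : ℕ) (a : Fin n), (a : ℕ) = k → g a = 0 from fun a ↦ h a a rfl
  intro k
  induction k using Nat.strong_induction_on with
  | _ k ih =>
    intro a hak
    have h := congrFun hg (π a)
    simp only [Finset.sum_apply, Pi.smul_apply, smul_eq_mul, Pi.zero_apply] at h
    rw [Finset.sum_eq_single a] at h
    · rwa [hdiag, mul_one] at h
    · intro b _ hba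
      rcases lt_or_gt_of_ne hba with hlt | hgt
      · rw [ih b (by omega) b rfl, zero_mul]
      · rw [hlow a b hgt, mul_zero]
    · exact fun h ↦ (h (Finset.mem_univ a)).elim

omit [Fintype J] in
/-- In a pivot family with entries in a subring `A`, every vector with entries in `A` has its
coordinates in `A`. [folklore] -/
theorem repr_mem_of_pivots (A : Subring K) (u : Module.Basis (Fin n) K (J → K)) (π : Fin n → J)
    (hint : ∀ a j, u a j ∈ A) (hdiag : ∀ a, u a (π a) = 1) (hlow : ∀ a b, a < b → u b (π a) = 0)
    (x : J → K) (hx : ∀ j, x j ∈ A) (a : Fin n) : u.repr x a ∈ A := by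
  suffices h : ∀ (k : ℕ) (a : Fin n), (a : ℕ) = k → u.repr x a ∈ A from h a a rfl
  intro k
  induction k using Nat.strong_induction_on with
  | _ k ih =>
    intro a hak
    -- evaluate `x = ∑ c_b u_b` at the pivot `π a`
    have hsum : x (π a) = ∑ b, u.repr x b * u b (π a) := by
      conv_lhs => rw [← u.sum_repr x]
      simp only [Finset.sum_apply, Pi.smul_apply, smul_eq_mul]
    rw [← Finset.add_sum_erase _ _ (Finset.mem_univ a), hdiag, mul_one] at hsum
    have hca : u.repr x a = x (π a) - ∑ b ∈ Finset.univ.erase a, u.repr x b * u b (π a) := by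
      rw [hsum]; ring
    rw [hca]
    refine A.sub_mem (hx _) (A.sum_mem fun b hb ↦ ?_)
    have hba : b ≠ a := Finset.ne_of_mem_erase hb
    rcases lt_or_gt_of_ne hba with hlt | hgt
    · exact A.mul_mem (ih b (by omega) b rfl) (hint _ _)
    · rw [hlow a b hgt, mul_zero]
      exact A.zero_mem

/-- **Pivoting by valuation.** A non-zero vector over the fraction field of a valuation ring has
an entry dividing all the others. [folklore] -/
theorem exists_pivot (A : ValuationSubring K) (v : J → K) (hv : v ≠ 0) :
    ∃ j₀, v j₀ ≠ 0 ∧ ∀ j, v j * (v j₀)⁻¹ ∈ A := by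
  obtain ⟨j₁, hj₁⟩ : ∃ j, v j ≠ 0 := Function.ne_iff.mp hv
  obtain ⟨j₀, -, hmax⟩ :=
    Finset.exists_max_image Finset.univ (fun j ↦ A.valuation (v j)) ⟨j₁, Finset.mem_univ _⟩
  have h0 : v j₀ ≠ 0 := by
    intro h0
    have := hmax j₁ (Finset.mem_univ _)
    rw [h0, map_zero, le_zero_iff, map_eq_zero] at this
    exact hj₁ this
  refine ⟨j₀, h0, fun j ↦ ?_⟩
  obtain ⟨a, ha⟩ := (A.valuation_le_iff _ _).mp (hmax j (Finset.mem_univ _))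
  rw [← ha, mul_assoc, mul_inv_cancel₀ h0, mul_one]
  exact a.2

/-- `K ∙ x ⊔ P = K ∙ y ⊔ P` when `x - y ∈ P`. [folklore] -/
theorem span_singleton_sup_eq_of_sub_mem {x y : V} {P : Submodule K V} (h : x - y ∈ P) :
    K ∙ x ⊔ P = K ∙ y ⊔ P := by
  have key : ∀ {x y : V}, x - y ∈ P → K ∙ x ⊔ P ≤ K ∙ y ⊔ P := by
    intro x y h
    refine sup_le ?_ le_sup_right
    rw [Submodule.span_singleton_le_iff_mem]
    have : x = y + (x - y) := by abel
    rw [this]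
    exact Submodule.add_mem _ (Submodule.mem_sup_left (Submodule.mem_span_singleton_self y))
      (Submodule.mem_sup_right h)
  refine le_antisymm (key h) (key ?_)
  rw [← neg_sub]
  exact P.neg_mem h

/-- **Adapted integral families** (Gaussian elimination with pivoting by valuation). For a
valuation subring `A ⊆ K` and a linearly independent family `w : Fin n → (J → K)` there is a family
`m : Fin n → (J → K)` with entries in `A`, with pivots (`m a (π a) = 1`, `m b (π a) = 0` for
`a < b`), spanning the same flag: `span (m '' {b | b < c}) = span (w '' {b | b < c})` for all `c`.
Equivalently `GL_J(K) = GL_J(A) · B(K)`. [folklore] -/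
theorem exists_adapted_pivot_family (A : ValuationSubring K) (w : Fin n → J → K)
    (hw : LinearIndependent K w) :
    ∃ (m : Fin n → J → K) (π : Fin n → J),
      (∀ a j, m a j ∈ A) ∧ (∀ a, m a (π a) = 1) ∧ (∀ a b, a < b → m b (π a) = 0) ∧
      ∀ c : ℕ, Submodule.span K (m '' {b | (b : ℕ) < c}) =
        Submodule.span K (w '' {b | (b : ℕ) < c}) := by
  classical
  -- a default pivot map (only needed to have a function `Fin n → J` at all)
  have hπ₀ : ∀ a : Fin n, ∃ j, w a j ≠ 0 := fun a ↦ Function.ne_iff.mp (hw.ne_zero a)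
  choose π₀ _ using hπ₀
  -- ### induction on a prefix
  suffices H : ∀ i ≤ n, ∃ (m : Fin n → J → K) (π : Fin n → J),
      (∀ a : Fin n, (a : ℕ) < i → ∀ j, m a j ∈ A) ∧
      (∀ a : Fin n, (a : ℕ) < i → m a (π a) = 1) ∧
      (∀ a b : Fin n, a < b → (b : ℕ) < i → m b (π a) = 0) ∧
      (∀ c : ℕ, c ≤ i → Submodule.span K (m '' {b | (b : ℕ) < c}) =
        Submodule.span K (w '' {b | (b : ℕ) < c})) by
    obtain ⟨m, π, h1, h2, h3, h4⟩ := H n le_rfl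
    refine ⟨m, π, fun a ↦ h1 a a.2, fun a ↦ h2 a a.2, fun a b hab ↦ h3 a b hab b.2, fun c ↦ ?_⟩
    rcases le_or_gt c n with hc | hc
    · exact h4 c hc
    · have hset : ∀ v : Fin n → J → K, v '' {b : Fin n | (b : ℕ) < c} = v '' {b | (b : ℕ) < n} :=
        fun v ↦ by
          congr 1
          ext b
          simp only [Set.mem_setOf_eq]
          exact ⟨fun _ ↦ b.2, fun _ ↦ b.2.trans hc⟩
      rw [hset m, hset w]
      exact h4 n le_rfl
  intro i
  induction i with
  | zero =>
    intro _
    refine ⟨w, π₀, fun a ha ↦ absurd ha (Nat.not_lt_zero _), fun a ha ↦ absurd ha (Nat.not_lt_zero _),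
      fun a b _ hb ↦ absurd hb (Nat.not_lt_zero _), fun c hc ↦ ?_⟩
    rfl
  | succ i IH =>
    intro hi
    obtain ⟨m, π, hint, hdiag, hlow, hspan⟩ := IH (Nat.le_of_succ_le hi)
    have hin : i < n := hi
    set a₀ : Fin n := ⟨i, hin⟩ with ha₀
    -- ### sequential elimination of the old pivots from `w a₀`
    obtain ⟨elim, elim_zero, elim_succ⟩ : ∃ elim : ℕ → J → K, elim 0 = w a₀ ∧
        ∀ c (h : c < n), elim (c + 1) = elim c - elim c (π ⟨c, h⟩) • m ⟨c, h⟩ := by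
      let step : ℕ → (J → K) → (J → K) := fun c v ↦
        if h : c < n then v - v (π ⟨c, h⟩) • m ⟨c, h⟩ else v
      refine ⟨fun c ↦ Nat.rec (motive := fun _ ↦ J → K) (w a₀) step c, rfl, fun c h ↦ ?_⟩
      change step c _ = _
      simp only [step, dif_pos h]
    -- `elim c ≡ w a₀` modulo the span of the `m b`, `b < c`
    have hE0 : ∀ c, c ≤ i → elim c - w a₀ ∈ Submodule.span K (m '' {b | (b : ℕ) < c}) := by
      intro c
      induction c with
      | zero => intro _; rw [elim_zero, sub_self]; exact Submodule.zero_mem _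
      | succ c ihc =>
        intro hc
        have hcn : c < n := by omega
        rw [elim_succ c hcn]
        have h1 : elim c - elim c (π ⟨c, hcn⟩) • m ⟨c, hcn⟩ - w a₀ =
            (elim c - w a₀) - elim c (π ⟨c, hcn⟩) • m ⟨c, hcn⟩ := by abel
        rw [h1]
        have hsub : {b : Fin n | (b : ℕ) < c} ⊆ {b : Fin n | (b : ℕ) < c + 1} :=
          fun b hb ↦ Nat.lt_succ_of_lt hb
        have hmem : m ⟨c, hcn⟩ ∈ m '' {b : Fin n | (b : ℕ) < c + 1} :=
          ⟨⟨c, hcn⟩, Nat.lt_succ_self c, rfl⟩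
        exact Submodule.sub_mem _ (Submodule.span_mono (Set.image_mono hsub) (ihc (by omega)))
          (Submodule.smul_mem _ _ (Submodule.subset_span hmem))
    -- `elim c` vanishes at the pivots `π b`, `b < c`
    have hE2 : ∀ c, c ≤ i → ∀ b : Fin n, (b : ℕ) < c → elim c (π b) = 0 := by
      intro c
      induction c with
      | zero => intro _ b hb; exact absurd hb (Nat.not_lt_zero _)
      | succ c ihc =>
        intro hc b hb
        have hcn : c < n := by omega
        rw [elim_succ c hcn, Pi.sub_apply, Pi.smul_apply, smul_eq_mul]
        rcases Nat.lt_succ_iff_lt_or_eq.mp hb with hlt | heq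
        · rw [ihc (by omega) b hlt, hlow b ⟨c, hcn⟩ (Fin.lt_def.mpr hlt) (by simpa using by omega),
            mul_zero, sub_zero]
        · have : b = ⟨c, hcn⟩ := Fin.ext heq
          subst this
          rw [hdiag _ (by simpa using by omega), mul_one, sub_self]
    -- the eliminated vector `u` is non-zero
    have hspan_i : Submodule.span K (m '' {b | (b : ℕ) < i}) =
        Submodule.span K (w '' {b | (b : ℕ) < i}) := hspan i le_rfl
    have hE0i := hE0 i le_rfl
    have hE2i := hE2 i le_rfl
    generalize hu : elim i = u at hE0i hE2i
    have hu0 : u ≠ 0 := by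
      intro h0
      have hmem : w a₀ ∈ Submodule.span K (w '' {b | (b : ℕ) < i}) := by
        rw [h0, zero_sub, Submodule.neg_mem_iff, hspan_i] at hE0i
        exact hE0i
      exact hw.notMem_span_image (s := {b | (b : ℕ) < i}) (by simp [ha₀]) hmem
    obtain ⟨j₀, hj₀, hdiv⟩ := exists_pivot A u hu0
    -- ### the new family
    let m' : Fin n → J → K := Function.update m a₀ (fun j ↦ u j * (u j₀)⁻¹)
    let π' : Fin n → J := Function.update π a₀ j₀
    have hm'old : ∀ b : Fin n, (b : ℕ) < i → m' b = m b := fun b hb ↦ by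
      have : b ≠ a₀ := fun h ↦ by simp [h, ha₀] at hb
      simp [m', this]
    have hπ'old : ∀ b : Fin n, (b : ℕ) < i → π' b = π b := fun b hb ↦ by
      have : b ≠ a₀ := fun h ↦ by simp [h, ha₀] at hb
      simp [π', this]
    have hm'new : m' a₀ = fun j ↦ u j * (u j₀)⁻¹ := by simp [m']
    have hπ'new : π' a₀ = j₀ := by simp [π']
    have hlt_succ : ∀ b : Fin n, (b : ℕ) < i + 1 ↔ (b : ℕ) < i ∨ b = a₀ := fun b ↦ by
      constructor
      · intro hb
        rcases Nat.lt_succ_iff_lt_or_eq.mp hb with h | h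
        · exact Or.inl h
        · exact Or.inr (Fin.ext h)
      · rintro (h | h)
        · omega
        · simp [h, ha₀]
    refine ⟨m', π', ?_, ?_, ?_, ?_⟩
    · -- entries in `A`
      intro a ha j
      rcases (hlt_succ a).mp ha with h | h
      · rw [hm'old a h]; exact hint a h j
      · subst h; rw [hm'new]; exact hdiv j
    · -- unit pivots
      intro a ha
      rcases (hlt_succ a).mp ha with h | h
      · rw [hm'old a h, hπ'old a h]; exact hdiag a h
      · subst h; rw [hm'new, hπ'new]; exact mul_inv_cancel₀ hj₀
    · -- vanishing below the pivots
      intro a b hab hb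
      rcases (hlt_succ b).mp hb with h | h
      · have ha : (a : ℕ) < i := lt_trans (Fin.lt_def.mp hab) h
        rw [hm'old b h, hπ'old a ha]
        exact hlow a b hab h
      · subst h
        have ha : (a : ℕ) < i := by simpa [ha₀] using Fin.lt_def.mp hab
        rw [hm'new, hπ'old a ha]
        change u (π a) * (u j₀)⁻¹ = 0
        rw [hE2i a ha, zero_mul]
    · -- the flag
      intro c hc
      rcases Nat.lt_succ_iff_lt_or_eq.mp (Nat.lt_succ_of_le hc) with hci | hci
      · -- `c ≤ i`: nothing changed
        have hci' : c ≤ i := Nat.lt_succ_iff.mp hci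
        have hcongr : ∀ b ∈ {b : Fin n | (b : ℕ) < c}, m' b = m b :=
          fun b hb ↦ hm'old b (lt_of_lt_of_le hb hci')
        rw [Set.image_congr hcongr]
        exact hspan c hci'
      · -- `c = i + 1`: the new vector
        subst hci
        have hset : ∀ v : Fin n → J → K,
            v '' {b : Fin n | (b : ℕ) < i + 1} = insert (v a₀) (v '' {b | (b : ℕ) < i}) := by
          intro v
          have : {b : Fin n | (b : ℕ) < i + 1} = insert a₀ {b : Fin n | (b : ℕ) < i} := by
            ext b
            simp only [Set.mem_setOf_eq, Set.mem_insert_iff]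
            rw [hlt_succ b, or_comm]
          rw [this, Set.image_insert_eq]
        have hcongr : ∀ b ∈ {b : Fin n | (b : ℕ) < i}, m' b = m b := fun b hb ↦ hm'old b hb
        rw [hset m', hset w, Submodule.span_insert, Submodule.span_insert, Set.image_congr hcongr,
          hspan_i]
        -- `K ∙ m' a₀ ⊔ P = K ∙ u ⊔ P = K ∙ w a₀ ⊔ P`
        have h1 : K ∙ m' a₀ = K ∙ u := by
          rw [hm'new]
          have : (fun j ↦ u j * (u j₀)⁻¹) = (u j₀)⁻¹ • u := by
            ext j; simp [mul_comm]
          rw [this]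
          exact Submodule.span_singleton_smul_eq (IsUnit.mk0 _ (inv_ne_zero hj₀)) u
        rw [h1]
        apply span_singleton_sup_eq_of_sub_mem
        rwa [hspan_i] at hE0i

end Pivot

/-! ### Reduction modulo the maximal ideal of a valuation ring: decomposition numbers -/

section Reduction

open IsLocalRing Matrix

variable {J : Type*} [Fintype J] [DecidableEq J]

/-- **Decomposition numbers along a triangular form.**  Let `A ⊆ K` be a valuation subring with
algebraically closed residue field `k`, `M t` (`t ∈ τ`) pairwise commuting `J × J` matrices over
`A`, and suppose the `M t` are simultaneously upper triangular over `K` in some basis `w` of `K^J`,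
with diagonal characters `θ i : τ → A`.  Then for every `χ : τ → k` the simultaneous generalised
eigenspace of `χ` for the reduced matrices `M t mod 𝔪` acting on `k^J` has dimension
`#{i | θ i mod 𝔪 = χ}`: the triangular form descends to an `A`-integral basis adapted to the same
flag (`exists_adapted_pivot_family`) and then reduces modulo `𝔪`. [folklore]
(Serre, *Linear representations of finite groups*, §15.2, for the principle; here for commuting
families via flags.) -/
theorem finrank_iInf_maxGenEigenspace_residue_eq_card (A : ValuationSubring K)
    [IsAlgClosed (ResidueField A)] {τ : Type*} (M : τ → Matrix J J A)
    (hcomm : ∀ s t, M s * M t = M t * M s) (w : Module.Basis (Fin n) K (J → K))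
    (θ : Fin n → τ → A)
    (htri : ∀ t i, ((M t).map (algebraMap A K)) *ᵥ (w i) - (θ i t : K) • w i ∈ w.flag i.castSucc)
    (χ : τ → ResidueField A) [DecidableEq (τ → ResidueField A)] :
    finrank (ResidueField A)
        ↥(⨅ t, Module.End.maxGenEigenspace (Matrix.toLin' ((M t).map (residue A))) (χ t)) =
      (Finset.univ.filter fun i : Fin n ↦ (fun t ↦ residue A (θ i t)) = χ).card := by
  classical
  -- ### the adapted integral family
  obtain ⟨m, π, hint, hdiag, hlow, hspan⟩ := exists_adapted_pivot_family A w w.linearIndependent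
  have hcardJ : Fintype.card J = n := by
    have := Module.finrank_fintype_fun_eq_card (R := K) (η := J)
    rw [finrank_eq_card_basis w, Fintype.card_fin] at this
    exact this.symm
  have hli : LinearIndependent K m := linearIndependent_of_pivots m π hdiag hlow
  let mK : Module.Basis (Fin n) K (J → K) := basisOfLinearIndependentOfCardEqFinrank' m hli
    (by rw [Module.finrank_fintype_fun_eq_card, hcardJ, Fintype.card_fin])
  have hmK : ∀ a, mK a = m a := fun a ↦ by simp [mK]
  have hflag : ∀ k, mK.flag k = w.flag k := by
    intro k
    simp only [Module.Basis.flag]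
    have h1 : ∀ v : Fin n → J → K, v '' {i : Fin n | i.castSucc < k} = v '' {b | (b : ℕ) < k} :=
      fun v ↦ by
        congr 1
    rw [show (⇑mK) = m from funext hmK, h1 m, h1 w, hspan k]
  -- triangularity in the adapted basis
  set L : τ → Module.End K (J → K) := fun t ↦ Matrix.toLin' ((M t).map (algebraMap A K)) with hL
  have htriL : ∀ t i, L t (w i) - (θ i t : K) • w i ∈ w.flag i.castSucc := fun t i ↦ by
    simpa [hL, Matrix.toLin'_apply] using htri t i
  have htri' : ∀ t i, L t (mK i) - (θ i t : K) • mK i ∈ mK.flag i.castSucc :=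
    triangular_of_flag_eq w mK L (fun i t ↦ (θ i t : K)) htriL hflag
  -- ### the remainders have `A`-integral coordinates, supported below the diagonal
  have hrem_int : ∀ t i j, (L t (mK i) - (θ i t : K) • mK i) j ∈ A.toSubring := by
    intro t i j
    simp only [hL, Matrix.toLin'_apply, hmK, Pi.sub_apply, Pi.smul_apply, smul_eq_mul,
      Matrix.mulVec, dotProduct, Matrix.map_apply]
    refine A.toSubring.sub_mem (A.toSubring.sum_mem fun l _ ↦ A.toSubring.mul_mem ?_ (hint i l))
      (A.toSubring.mul_mem (θ i t).2 (hint i j))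
    exact ((M t) j l).2
  set c : τ → Fin n → Fin n → K := fun t i b ↦ mK.repr (L t (mK i) - (θ i t : K) • mK i) b
    with hc
  have hc_int : ∀ t i b, c t i b ∈ A := fun t i b ↦
    repr_mem_of_pivots A.toSubring mK π (fun a j ↦ by rw [hmK]; exact hint a j)
      (fun a ↦ by rw [hmK]; exact hdiag a) (fun a b hab ↦ by rw [hmK]; exact hlow a b hab)
      _ (hrem_int t i) b
  have hc_zero : ∀ t i b, i ≤ b → c t i b = 0 := fun t i b hib ↦
    LinearMap.mem_ker.mp (mK.flag_le_ker_coord (Fin.castSucc_le_castSucc_iff.mpr hib) (htri' t i))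
  -- the identity `M t • m i = θ i t • m i + ∑ c • m b` over `K` ...
  have hKid : ∀ t i, ((M t).map (algebraMap A K)) *ᵥ (m i) =
      (θ i t : K) • m i + ∑ b, c t i b • m b := by
    intro t i
    have h := mK.sum_repr (L t (mK i) - (θ i t : K) • mK i)
    have h' : L t (mK i) = (θ i t : K) • mK i + ∑ b, c t i b • mK b := by
      rw [hc]; exact sub_eq_iff_eq_add'.mp h.symm
    simp only [hmK, hL, Matrix.toLin'_apply] at h'
    exact h'
  -- ... hence over `A` ...
  let mA : Fin n → J → A := fun a j ↦ ⟨m a j, hint a j⟩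
  let cA : τ → Fin n → Fin n → A := fun t i b ↦ ⟨c t i b, hc_int t i b⟩
  have hAid : ∀ t i, (M t) *ᵥ (mA i) = θ i t • mA i + ∑ b, cA t i b • mA b := by
    intro t i
    have hinj : Function.Injective (fun v : J → A ↦ (fun j ↦ (v j : K))) := by
      intro v v' h
      ext j
      exact congrFun h j
    apply hinj
    ext j
    have h1 := congrFun (hKid t i) j
    have h2 : (((M t) *ᵥ mA i) j : K) = (((M t).map (algebraMap A K)) *ᵥ m i) j := by
      have := RingHom.map_mulVec (algebraMap A K) (M t) (mA i) j
      rw [ValuationSubring.algebraMap_apply] at this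
      rw [this]
      rfl
    change (((M t) *ᵥ mA i) j : K) = ((θ i t • mA i + ∑ b, cA t i b • mA b) j : K)
    rw [h2, h1]
    simp only [Pi.add_apply, Pi.smul_apply, Finset.sum_apply, smul_eq_mul]
    push_cast
    rfl
  -- ### ... and modulo `𝔪`
  let mk : Fin n → J → ResidueField A := fun a j ↦ residue A (mA a j)
  have hkid : ∀ t i, ((M t).map (residue A)) *ᵥ (mk i) =
      residue A (θ i t) • mk i + ∑ b, residue A (cA t i b) • mk b := by
    intro t i
    ext j
    have h1 := RingHom.map_mulVec (residue A) (M t) (mA i) j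
    have h2 := congrArg (residue A) (congrFun (hAid t i) j)
    rw [h1] at h2
    simp only [Pi.add_apply, Pi.smul_apply, Finset.sum_apply, smul_eq_mul, map_add, map_mul,
      map_sum] at h2
    simp only [Pi.add_apply, Pi.smul_apply, Finset.sum_apply, smul_eq_mul]
    exact h2
  -- pivots survive reduction
  have hmA_diag : ∀ a, mA a (π a) = 1 := fun a ↦ Subtype.ext (hdiag a)
  have hmA_low : ∀ a b, a < b → mA b (π a) = 0 := fun a b hab ↦ Subtype.ext (hlow a b hab)
  have hmk_diag : ∀ a, mk a (π a) = 1 := fun a ↦ by simp [mk, hmA_diag]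
  have hmk_low : ∀ a b, a < b → mk b (π a) = 0 := fun a b hab ↦ by simp [mk, hmA_low a b hab]
  have hlik : LinearIndependent (ResidueField A) mk :=
    linearIndependent_of_pivots mk π hmk_diag hmk_low
  let mkB : Module.Basis (Fin n) (ResidueField A) (J → ResidueField A) :=
    basisOfLinearIndependentOfCardEqFinrank' mk hlik
    (by rw [Module.finrank_fintype_fun_eq_card, hcardJ, Fintype.card_fin])
  have hmkB : ∀ a, mkB a = mk a := fun a ↦ by simp [mkB]
  -- the reduced family is triangular in `mkB` with diagonal characters `θ mod 𝔪`
  set Lk : τ → Module.End (ResidueField A) (J → ResidueField A) :=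
    fun t ↦ Matrix.toLin' ((M t).map (residue A)) with hLk
  have hcA_zero : ∀ t i b, i ≤ b → cA t i b = 0 := fun t i b hib ↦ Subtype.ext (hc_zero t i b hib)
  have htrik : ∀ t i, Lk t (mkB i) - (fun i t ↦ residue A (θ i t)) i t • mkB i ∈
      mkB.flag i.castSucc := by
    intro t i
    have h1 : Lk t (mkB i) - residue A (θ i t) • mkB i = ∑ b, residue A (cA t i b) • mk b := by
      rw [hmkB, hLk]
      simp only [Matrix.toLin'_apply]
      rw [hkid t i, add_sub_cancel_left]
    rw [h1]
    refine Submodule.sum_mem _ fun b _ ↦ ?_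
    rcases lt_or_ge b i with hbi | hbi
    · rw [← hmkB]
      exact Submodule.smul_mem _ _ (mkB.self_mem_flag (Fin.castSucc_lt_castSucc_iff.mpr hbi))
    · rw [hcA_zero t i b hbi, map_zero, zero_smul]
      exact Submodule.zero_mem _
  have hcommk : ∀ s t, Commute (Lk s) (Lk t) := by
    intro s t
    change Lk s * Lk t = Lk t * Lk s
    rw [hLk]
    simp only
    rw [Module.End.mul_eq_comp, Module.End.mul_eq_comp, ← Matrix.toLin'_mul, ← Matrix.toLin'_mul,
      ← Matrix.map_mul, ← Matrix.map_mul, hcomm]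
  have key := finrank_iInf_maxGenEigenspace_eq_card mkB Lk (fun i t ↦ residue A (θ i t)) htrik
    hcommk χ
  rw [hLk] at key
  exact key

end Reduction

end Literature.NumberTheory.EllipticCurves.ModularForms.HidaRank

end
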